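import Mathlib
import HarnessLib

/-!
# Separated points near (or far from) rationals of small denominator — the counting device of the
# Huxley–Watt "minor arcs" (PROVED)

Topic `Literature/NumberTheory/DiophantineApproximation`. In the Bombieri–Iwaniec–Huxley–Watt
treatment of exponential sums `∑ e(f(m))` (M. N. Huxley, N. Watt, *Exponential sums and the Riemann
zeta function*, Proc. LMS (3) 57 (1988) 1–24, §4 Step 1 and Lemma 2.1; J. Bourgain, *Decoupling,
exponential sums and the Riemann zeta function*, J. AMS 30 (2017), §4, display after (3.4):
"`∑_ℓ |𝓘(Q, ℓ)| ≪ MR²/(NQ²) + R²/Q`") the range of summation is cut into blocks `I` of length `N`;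
the block is assigned the reduced rational `a/q` of least denominator in a window of length `≍ 1/R²`
around the value `f''(m_I)/2` (the "arc" `J(I)`), and one needs to know that blocks whose least
denominator is `≥ Q` are rare — at most `≍ (M/N)(R/Q)²` of the `M/N` blocks — while blocks whose
window holds a rational with denominator in `[Q, 2Q)`, `Q < R`, are at most `≍ (M/N)(Q/R)²`.

Both counts are proved here for an arbitrary finite `δ`-separated set `P` of reals lying in an
interval of length `Λ` (in the application `δ ≍ η ≍ 1/R²`, `Λ ≍ T/M²`, `#P ≍ M/N ≍ Λ/δ`):

* `card_filter_farFromRationals_le` — for `η > 0`, `Q ≥ 2`: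
  `#{x ∈ P : no a/q with 0 < q < Q has |x - a/q| < η} ≤ (1/(ηQ))((2Λ + 4)/(Qδ) + 2) + Λ/(ηQ)²`.
  Proof (three lines, no Farey sequences): Dirichlet's theorem at level `Q - 1`
  (`Real.exists_nat_abs_mul_sub_round_le`) gives `k < Q` with `|x - a/k| ≤ 1/(kQ)`; since `x` is
  `η`-far from `a/k`, `k ≤ 1/(ηQ)` (`FarFromRationals.exists_small_denominator`); for each such `k`
  there are `≤ kΛ + 2` relevant `a`, and a window of length `2/(kQ)` holds `≤ 2/(kQδ) + 1` points.
  With `η = δ = 1/R²` this is `≤ (2Λ + 4)R⁴/Q² + ΛR⁴/Q² + 2R²/Q`, the shape of [H-W] Lemma 2.1.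
* `card_filter_exists_near_rational_le` — for `η ≥ 0`, `0 < Q₁ ≤ Q₂`:
  `#{x ∈ P : ∃ a/q, Q₁ ≤ q < Q₂, |x - a/q| ≤ η} ≤ (Q₂ - Q₁)(Q₂(Λ + 2η) + 1)(2η/δ + 1)`.
* Tools: `FarFromRationals` (the predicate, with `farFromRationals_iff`), `card_le_of_separated`
  (`δ`-separated points in an interval of length `ℓ` number `≤ ℓ/δ + 1`, by the injection
  `x ↦ ⌊(x - u)/δ⌋`), `card_Icc_ceil_floor_le` (integers in `[α, β]`), `exists_near_rational`
  (every real is within `η` of some `a/q` with `q ≤ 1/(2η) + 1`, so least denominators are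
  `≤ 1/(2η) + 1`).

Everything is PROVED; no named fact is introduced.

## References

* M. N. Huxley, N. Watt, *Exponential sums and the Riemann zeta function*, Proc. London Math. Soc.
  (3) 57 (1988), 1–24 — Lemma 2.1, §4 Step 1. [HuxleyWatt1988]
* J. Bourgain, *Decoupling, exponential sums and the Riemann zeta function*, J. Amer. Math. Soc. 30
  (2017), 205–224 — §4, the count of minor arcs after (3.4). [cite: BourgainJAMS2017, §4 (3.4)]
* P. G. L. Dirichlet's approximation theorem — Mathlib `Real.exists_nat_abs_mul_sub_round_le`.
-/

noncomputable section

open Finset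

namespace Literature.NumberTheory.DiophantineApproximation

/-- `FarFromRationals η Q x`: no rational number `a/q` with denominator `0 < q < Q` lies within
distance `< η` of `x`, i.e. `|x - a/q| ≥ η` for all integers `a` and all `0 < q < Q`. [folklore] -/
def FarFromRationals (η : ℝ) (Q : ℕ) (x : ℝ) : Prop :=
  ∀ q : ℕ, 0 < q → q < Q → ∀ a : ℤ, η ≤ |x - a / q|

/-- Unfolding lemma for `FarFromRationals`. [folklore] -/
theorem farFromRationals_iff (η : ℝ) (Q : ℕ) (x : ℝ) :
    FarFromRationals η Q x ↔ ∀ q : ℕ, 0 < q → q < Q → ∀ a : ℤ, η ≤ |x - a / q| := Iff.rfl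

/-- **Dirichlet's theorem forces a good approximation of small denominator.** If no `a/q` with
`q < Q` (`Q ≥ 2`) is within `η` of `x`, then there is `k ≥ 1` with `k ≤ 1/(ηQ)` and
`|x - round(kx)/k| ≤ 1/(kQ)`. [folklore] -/
theorem FarFromRationals.exists_small_denominator {η : ℝ} {Q : ℕ} {x : ℝ} (hx : FarFromRationals η Q x)
    (hη : 0 < η) (hQ : 2 ≤ Q) :
    ∃ k : ℕ, 0 < k ∧ (k : ℝ) ≤ 1 / (η * Q) ∧ |x - round ((k : ℝ) * x) / k| ≤ 1 / ((k : ℝ) * Q) := by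
  have hQ1 : 0 < Q - 1 := by omega
  obtain ⟨k, hk0, hkQ, hk⟩ := Real.exists_nat_abs_mul_sub_round_le x hQ1
  have hkR : (0 : ℝ) < k := by exact_mod_cast hk0
  have hQR : (0 : ℝ) < Q := by exact_mod_cast (by omega : 0 < Q)
  have hQ' : ((Q - 1 : ℕ) : ℝ) + 1 = Q := by
    rw [Nat.cast_sub (by omega : 1 ≤ Q)]; push_cast; ring
  rw [hQ'] at hk
  -- `|x - round(kx)/k| ≤ 1/(kQ)`
  have happrox : |x - round ((k : ℝ) * x) / k| ≤ 1 / ((k : ℝ) * Q) := by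
    have e : x - round ((k : ℝ) * x) / k = ((k : ℝ) * x - round ((k : ℝ) * x)) / k := by
      field_simp
    rw [e, abs_div, abs_of_pos hkR, div_le_div_iff₀ hkR (by positivity)]
    calc |(k : ℝ) * x - round ((k : ℝ) * x)| * (k * Q) = (|(k : ℝ) * x - round ((k : ℝ) * x)| * Q) * k := by ring
      _ ≤ (1 / Q * Q) * k := by gcongr
      _ = 1 * k := by rw [one_div, inv_mul_cancel₀ hQR.ne']
  refine ⟨k, hk0, ?_, happrox⟩
  -- `η ≤ |x - round(kx)/k| ≤ 1/(kQ)` gives `k ≤ 1/(ηQ)`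
  have hfar := hx k hk0 (by omega) (round ((k : ℝ) * x))
  have h1 : η ≤ 1 / ((k : ℝ) * Q) := hfar.trans happrox
  rw [le_div_iff₀ (by positivity)] at h1
  rw [le_div_iff₀ (by positivity)]
  nlinarith

/-- `δ`-separated points in an interval of length `ℓ` number at most `ℓ/δ + 1`. [folklore] -/
theorem card_le_of_separated {P : Finset ℝ} {δ ℓ u : ℝ} (hδ : 0 < δ) (hℓ : 0 ≤ ℓ)
    (hsep : ∀ x ∈ P, ∀ y ∈ P, x ≠ y → δ ≤ |x - y|) (hP : ∀ x ∈ P, x ∈ Set.Icc u (u + ℓ)) :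
    (P.card : ℝ) ≤ ℓ / δ + 1 := by
  classical
  -- `x ↦ ⌊(x - u)/δ⌋` is injective on `P` with values in `[0, ⌊ℓ/δ⌋]`
  set g : ℝ → ℤ := fun x => ⌊(x - u) / δ⌋ with hg
  have hinj : Set.InjOn g P := by
    intro x hx y hy hxy
    by_contra hne
    have hd := hsep x hx y hy hne
    simp only [hg] at hxy
    rcases lt_or_gt_of_ne hne with hlt | hlt
    · have : (x - u) / δ + 1 ≤ (y - u) / δ := by
        rw [div_add_one hδ.ne', div_le_div_iff_of_pos_right hδ]
        rw [abs_sub_comm, abs_of_pos (sub_pos.2 hlt)] at hd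
        linarith
      have h2 := Int.floor_le_floor this
      rw [Int.floor_add_one] at h2
      omega
    · have : (y - u) / δ + 1 ≤ (x - u) / δ := by
        rw [div_add_one hδ.ne', div_le_div_iff_of_pos_right hδ]
        rw [abs_of_pos (sub_pos.2 hlt)] at hd
        linarith
      have h2 := Int.floor_le_floor this
      rw [Int.floor_add_one] at h2
      omega
  have hmaps : Set.MapsTo g P (Finset.Icc (0 : ℤ) ⌊ℓ / δ⌋) := by
    intro x hx
    have hx' := hP x hx
    simp only [coe_Icc, Set.mem_Icc, hg]
    constructor
    · exact Int.floor_nonneg.2 (div_nonneg (by linarith [hx'.1]) hδ.le)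
    · exact Int.floor_le_floor (div_le_div_of_nonneg_right (by linarith [hx'.2]) hδ.le)
  have hcard := Finset.card_le_card_of_injOn g hmaps hinj
  have hfl : 0 ≤ ⌊ℓ / δ⌋ := Int.floor_nonneg.2 (div_nonneg hℓ hδ.le)
  rw [Int.card_Icc, sub_zero] at hcard
  have h1 : ((P.card : ℤ) : ℝ) ≤ ((⌊ℓ / δ⌋ + 1).toNat : ℤ) := by exact_mod_cast hcard
  rw [Int.toNat_of_nonneg (by omega)] at h1
  push_cast at h1
  linarith [Int.floor_le (ℓ / δ)]

/-- Number of integers in `[α, β]`: `#(Icc ⌈α⌉ ⌊β⌋) ≤ β - α + 1` (for `α ≤ β + 1`). [folklore] -/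
theorem card_Icc_ceil_floor_le {α β : ℝ} (h : α ≤ β + 1) :
    ((Finset.Icc ⌈α⌉ ⌊β⌋).card : ℝ) ≤ β - α + 1 := by
  rw [Int.card_Icc]
  rcases le_or_gt 0 (⌊β⌋ + 1 - ⌈α⌉) with h0 | h0
  · have : (((⌊β⌋ + 1 - ⌈α⌉).toNat : ℤ) : ℝ) = ((⌊β⌋ + 1 - ⌈α⌉ : ℤ) : ℝ) := by
      rw [Int.toNat_of_nonneg h0]
    have h1 : (((⌊β⌋ + 1 - ⌈α⌉).toNat : ℕ) : ℝ) = ((⌊β⌋ : ℝ) + 1 - ⌈α⌉) := by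
      rw [show (((⌊β⌋ + 1 - ⌈α⌉).toNat : ℕ) : ℝ) = (((⌊β⌋ + 1 - ⌈α⌉).toNat : ℤ) : ℝ) by norm_cast, this]
      push_cast; ring
    rw [h1]
    linarith [Int.floor_le β, Int.le_ceil α]
  · rw [Int.toNat_of_nonpos h0.le]
    simp only [CharP.cast_eq_zero]
    linarith

/-- **Every real number is `η`-close to a rational of denominator `≤ 1/(2η) + 1`** (`q = ⌈1/(2η)⌉`,
`a = round(qx)`); hence the least denominator of a rational in any window of radius `η` is at most
`1/(2η) + 1`. [folklore] -/
theorem exists_near_rational (x : ℝ) {η : ℝ} (hη : 0 < η) :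
    ∃ q : ℕ, 0 < q ∧ (q : ℝ) ≤ 1 / (2 * η) + 1 ∧ ∃ a : ℤ, |x - a / q| ≤ η := by
  set q : ℕ := ⌈1 / (2 * η)⌉₊ with hq
  have hq0 : 0 < q := Nat.ceil_pos.2 (by positivity)
  have hqR : (0 : ℝ) < q := by exact_mod_cast hq0
  have hqle : (q : ℝ) ≤ 1 / (2 * η) + 1 := (Nat.ceil_lt_add_one (by positivity)).le
  have hqge : 1 / (2 * η) ≤ q := Nat.le_ceil _
  refine ⟨q, hq0, hqle, round ((q : ℝ) * x), ?_⟩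
  have hr : |(q : ℝ) * x - round ((q : ℝ) * x)| ≤ 1 / 2 := by
    have := abs_sub_round ((q : ℝ) * x); linarith
  have e : x - (round ((q : ℝ) * x) : ℝ) / q = ((q : ℝ) * x - round ((q : ℝ) * x)) / q := by
    field_simp
  rw [e, abs_div, abs_of_pos hqR, div_le_iff₀ hqR]
  rw [div_le_iff₀ (by positivity)] at hqge
  nlinarith

/-- **Points far from all rationals of small denominator are few** (the counting device behind
Huxley–Watt's Lemma 2.1 / Bourgain's `∑_ℓ |𝓘(Q,ℓ)| ≪ MR²/(NQ²) + R²/Q`). Let `P` be a finite set of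
`δ`-separated reals in an interval of length `Λ`, `η > 0`, `Q ≥ 2`. The number of `x ∈ P` admitting
NO rational `a/q` with `0 < q < Q` and `|x - a/q| < η` is at most
`(1/(ηQ)) ((2Λ + 4)/(Qδ) + 2) + Λ/(ηQ)²`.
Proof: by Dirichlet's theorem (level `Q - 1`) such an `x` lies within `1/(kQ)` of some `a/k` with
`1 ≤ k ≤ 1/(ηQ)`; for each `k` there are `≤ kΛ + 2` relevant `a`, and each window of length `2/(kQ)`
holds `≤ 2/(kQδ) + 1` points of `P`. Compare Huxley–Watt (1988), Lemma 2.1, and Bourgain (2017), §4,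
the display after (3.4); the statement and proof here are self-contained. [folklore] -/
theorem card_filter_farFromRationals_le (P : Finset ℝ) {δ η Λ u : ℝ} (hδ : 0 < δ) (hη : 0 < η)
    (hΛ : 0 ≤ Λ) (hsep : ∀ x ∈ P, ∀ y ∈ P, x ≠ y → δ ≤ |x - y|)
    (hP : ∀ x ∈ P, x ∈ Set.Icc u (u + Λ)) {Q : ℕ} (hQ : 2 ≤ Q) [DecidablePred (FarFromRationals η Q)] :
    ((P.filter (FarFromRationals η Q)).card : ℝ) ≤
      1 / (η * Q) * ((2 * Λ + 4) / (Q * δ) + 2) + Λ / (η * Q) ^ 2 := by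
  classical
  have hQR : (0 : ℝ) < Q := by exact_mod_cast (by omega : 0 < Q)
  set K₀ : ℕ := ⌊1 / (η * Q)⌋₊ with hK₀
  have hK₀le : (K₀ : ℝ) ≤ 1 / (η * Q) := Nat.floor_le (by positivity)
  -- the windows
  set J : ℕ → Finset ℤ := fun k => Finset.Icc ⌈(k : ℝ) * u - 1 / 2⌉ ⌊(k : ℝ) * u + k * Λ + 1 / 2⌋ with hJ
  set C : ℕ → ℤ → Finset ℝ := fun k j =>
    P.filter (fun x => |x - (j : ℝ) / k| ≤ 1 / ((k : ℝ) * Q)) with hC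
  -- covering
  have hcover : P.filter (FarFromRationals η Q) ⊆
      (Finset.Icc 1 K₀).biUnion fun k => (J k).biUnion fun j => C k j := by
    intro x hx
    rw [Finset.mem_filter] at hx
    obtain ⟨k, hk0, hkle, hkx⟩ := hx.2.exists_small_denominator hη hQ
    rw [Finset.mem_biUnion]
    refine ⟨k, Finset.mem_Icc.2 ⟨hk0, Nat.le_floor hkle⟩, ?_⟩
    rw [Finset.mem_biUnion]
    refine ⟨round ((k : ℝ) * x), ?_, ?_⟩
    · have hxu := hP x hx.1
      have hkR : (0 : ℝ) < k := by exact_mod_cast hk0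
      have h1 := round_le ((k : ℝ) * x) 0
      have hr : |(k : ℝ) * x - round ((k : ℝ) * x)| ≤ 1 / 2 := by
        have := abs_sub_round ((k : ℝ) * x); linarith
      rw [abs_le] at hr
      simp only [hJ, Finset.mem_Icc]
      constructor
      · rw [Int.ceil_le]
        have : (k : ℝ) * u ≤ (k : ℝ) * x := mul_le_mul_of_nonneg_left hxu.1 hkR.le
        linarith
      · rw [Int.le_floor]
        have : (k : ℝ) * x ≤ (k : ℝ) * (u + Λ) := mul_le_mul_of_nonneg_left hxu.2 hkR.le
        linarith
    · simp only [hC, Finset.mem_filter]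
      exact ⟨hx.1, hkx⟩
  -- sizes of the pieces
  have hCcard : ∀ k : ℕ, 0 < k → ∀ j : ℤ, ((C k j).card : ℝ) ≤ 2 / ((k : ℝ) * Q * δ) + 1 := by
    intro k hk j
    have hkR : (0 : ℝ) < k := by exact_mod_cast hk
    have h := card_le_of_separated (P := C k j) (u := (j : ℝ) / k - 1 / ((k : ℝ) * Q))
      (ℓ := 2 / ((k : ℝ) * Q)) hδ (by positivity)
      (fun x hx y hy hxy => hsep x (Finset.mem_filter.1 hx).1 y (Finset.mem_filter.1 hy).1 hxy)
      (fun x hx => by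
        have hx' := (Finset.mem_filter.1 hx).2
        rw [abs_le] at hx'
        have e2 : (2 : ℝ) / ((k : ℝ) * Q) = 2 * (1 / ((k : ℝ) * Q)) := by ring
        constructor <;> linarith [hx'.1, hx'.2])
    calc ((C k j).card : ℝ) ≤ 2 / ((k : ℝ) * Q) / δ + 1 := h
      _ = 2 / ((k : ℝ) * Q * δ) + 1 := by rw [div_div]
  have hJcard : ∀ k : ℕ, ((J k).card : ℝ) ≤ k * Λ + 2 := by
    intro k
    have hk : (0 : ℝ) ≤ k := Nat.cast_nonneg _
    have h := card_Icc_ceil_floor_le (α := (k : ℝ) * u - 1 / 2) (β := (k : ℝ) * u + k * Λ + 1 / 2)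
      (by nlinarith)
    calc ((J k).card : ℝ) ≤ (k : ℝ) * u + k * Λ + 1 / 2 - ((k : ℝ) * u - 1 / 2) + 1 := h
      _ = k * Λ + 2 := by ring
  -- the count
  have h1 : ((P.filter (FarFromRationals η Q)).card : ℝ) ≤
      ∑ k ∈ Finset.Icc 1 K₀, ∑ j ∈ J k, ((C k j).card : ℝ) := by
    have := Finset.card_le_card hcover
    have h2 : (((Finset.Icc 1 K₀).biUnion fun k => (J k).biUnion fun j => C k j).card : ℝ) ≤
        ∑ k ∈ Finset.Icc 1 K₀, (((J k).biUnion fun j => C k j).card : ℝ) := by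
      exact_mod_cast Finset.card_biUnion_le
    have h3 : ∀ k, (((J k).biUnion fun j => C k j).card : ℝ) ≤ ∑ j ∈ J k, ((C k j).card : ℝ) := by
      intro k; exact_mod_cast Finset.card_biUnion_le
    calc ((P.filter (FarFromRationals η Q)).card : ℝ)
        ≤ (((Finset.Icc 1 K₀).biUnion fun k => (J k).biUnion fun j => C k j).card : ℝ) := by
          exact_mod_cast this
      _ ≤ ∑ k ∈ Finset.Icc 1 K₀, (((J k).biUnion fun j => C k j).card : ℝ) := h2
      _ ≤ ∑ k ∈ Finset.Icc 1 K₀, ∑ j ∈ J k, ((C k j).card : ℝ) := Finset.sum_le_sum fun k _ => h3 k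
  have h2 : ∀ k ∈ Finset.Icc 1 K₀, ∑ j ∈ J k, ((C k j).card : ℝ) ≤
      (2 * Λ + 4) / (Q * δ) + 2 + K₀ * Λ := by
    intro k hk
    rw [Finset.mem_Icc] at hk
    have hk0 : 0 < k := hk.1
    have hkR : (1 : ℝ) ≤ k := by exact_mod_cast hk.1
    have hkK : (k : ℝ) ≤ K₀ := by exact_mod_cast hk.2
    calc ∑ j ∈ J k, ((C k j).card : ℝ) ≤ ∑ _j ∈ J k, (2 / ((k : ℝ) * Q * δ) + 1) :=
          Finset.sum_le_sum fun j _ => hCcard k hk0 j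
      _ = ((J k).card : ℝ) * (2 / ((k : ℝ) * Q * δ) + 1) := by rw [Finset.sum_const, nsmul_eq_mul]
      _ ≤ (k * Λ + 2) * (2 / ((k : ℝ) * Q * δ) + 1) := by gcongr; exact hJcard k
      _ = 2 * Λ / (Q * δ) + 4 / ((k : ℝ) * (Q * δ)) + k * Λ + 2 := by
          field_simp; ring
      _ ≤ 2 * Λ / (Q * δ) + 4 / (1 * (Q * δ)) + K₀ * Λ + 2 := by gcongr
      _ = (2 * Λ + 4) / (Q * δ) + 2 + K₀ * Λ := by ring
  calc ((P.filter (FarFromRationals η Q)).card : ℝ)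
      ≤ ∑ k ∈ Finset.Icc 1 K₀, ∑ j ∈ J k, ((C k j).card : ℝ) := h1
    _ ≤ ∑ _k ∈ Finset.Icc 1 K₀, ((2 * Λ + 4) / (Q * δ) + 2 + K₀ * Λ) := Finset.sum_le_sum h2
    _ = K₀ * ((2 * Λ + 4) / (Q * δ) + 2 + K₀ * Λ) := by
        rw [Finset.sum_const, nsmul_eq_mul, Nat.card_Icc]; norm_num
    _ = K₀ * ((2 * Λ + 4) / (Q * δ) + 2) + Λ * K₀ ^ 2 := by ring
    _ ≤ 1 / (η * Q) * ((2 * Λ + 4) / (Q * δ) + 2) + Λ * (1 / (η * Q)) ^ 2 := by gcongr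
    _ = 1 / (η * Q) * ((2 * Λ + 4) / (Q * δ) + 2) + Λ / (η * Q) ^ 2 := by
        field_simp


/-- **Points near rationals with denominator in a given range are few.** Let `P` be a finite set of
`δ`-separated reals in an interval of length `Λ`, `η ≥ 0` and `0 < Q₁ ≤ Q₂`. The number of `x ∈ P`
having some rational `a/q`, `Q₁ ≤ q < Q₂`, with `|x - a/q| ≤ η` is at most
`(Q₂ - Q₁) (Q₂ (Λ + 2η) + 1) (2η/δ + 1)`
(for each `q` there are `≤ q(Λ + 2η) + 1` relevant `a`, and each window `[a/q - η, a/q + η]` holds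
`≤ 2η/δ + 1` points of `P`). [folklore] -/
theorem card_filter_exists_near_rational_le (P : Finset ℝ) {δ η Λ u : ℝ} (hδ : 0 < δ) (hη : 0 ≤ η)
    (hΛ : 0 ≤ Λ) (hsep : ∀ x ∈ P, ∀ y ∈ P, x ≠ y → δ ≤ |x - y|)
    (hP : ∀ x ∈ P, x ∈ Set.Icc u (u + Λ)) {Q₁ Q₂ : ℕ} (hQ₁ : 0 < Q₁) (hQ : Q₁ ≤ Q₂)
    [DecidablePred fun x : ℝ => ∃ q : ℕ, Q₁ ≤ q ∧ q < Q₂ ∧ ∃ a : ℤ, |x - a / q| ≤ η] :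
    ((P.filter fun x : ℝ => ∃ q : ℕ, Q₁ ≤ q ∧ q < Q₂ ∧ ∃ a : ℤ, |x - a / q| ≤ η).card : ℝ) ≤
      ((Q₂ : ℝ) - Q₁) * (Q₂ * (Λ + 2 * η) + 1) * (2 * η / δ + 1) := by
  classical
  set A : ℕ → Finset ℤ := fun q => Finset.Icc ⌈(q : ℝ) * u - q * η⌉ ⌊(q : ℝ) * u + q * Λ + q * η⌋ with hA
  set C : ℕ → ℤ → Finset ℝ := fun q a => P.filter (fun x => |x - (a : ℝ) / q| ≤ η) with hC
  have hcover : (P.filter fun x : ℝ => ∃ q : ℕ, Q₁ ≤ q ∧ q < Q₂ ∧ ∃ a : ℤ, |x - a / q| ≤ η) ⊆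
      (Finset.Ico Q₁ Q₂).biUnion fun q => (A q).biUnion fun a => C q a := by
    intro x hx
    rw [Finset.mem_filter] at hx
    obtain ⟨q, hq1, hq2, a, ha⟩ := hx.2
    rw [Finset.mem_biUnion]
    refine ⟨q, Finset.mem_Ico.2 ⟨hq1, hq2⟩, ?_⟩
    rw [Finset.mem_biUnion]
    refine ⟨a, ?_, ?_⟩
    · have hxu := hP x hx.1
      have hqR : (0 : ℝ) < q := by exact_mod_cast hQ₁.trans_le hq1
      have ha' := ha
      rw [abs_le] at ha'
      have e : x - (a : ℝ) / q = (x * q - a) / q := by field_simp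
      rw [e, le_div_iff₀ hqR, div_le_iff₀ hqR] at ha'
      simp only [hA, Finset.mem_Icc]
      constructor
      · rw [Int.ceil_le]
        have : (q : ℝ) * u ≤ x * q := by nlinarith [hxu.1]
        nlinarith [ha'.1, ha'.2]
      · rw [Int.le_floor]
        have : x * q ≤ (q : ℝ) * (u + Λ) := by nlinarith [hxu.2]
        nlinarith [ha'.1, ha'.2]
    · simp only [hC, Finset.mem_filter]
      exact ⟨hx.1, ha⟩
  have hCcard : ∀ q : ℕ, 0 < q → ∀ a : ℤ, ((C q a).card : ℝ) ≤ 2 * η / δ + 1 := by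
    intro q hq a
    exact card_le_of_separated (P := C q a) (u := (a : ℝ) / q - η) (ℓ := 2 * η) hδ (by positivity)
      (fun x hx y hy hxy => hsep x (Finset.mem_filter.1 hx).1 y (Finset.mem_filter.1 hy).1 hxy)
      (fun x hx => by
        have hx' := (Finset.mem_filter.1 hx).2
        rw [abs_le] at hx'
        constructor <;> linarith [hx'.1, hx'.2])
  have hAcard : ∀ q : ℕ, Q₁ ≤ q → q < Q₂ → ((A q).card : ℝ) ≤ Q₂ * (Λ + 2 * η) + 1 := by
    intro q hq1 hq2
    have hq : (0 : ℝ) ≤ q := Nat.cast_nonneg _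
    have hqQ : (q : ℝ) ≤ Q₂ := by exact_mod_cast hq2.le
    have h := card_Icc_ceil_floor_le (α := (q : ℝ) * u - q * η) (β := (q : ℝ) * u + q * Λ + q * η)
      (by nlinarith)
    calc ((A q).card : ℝ) ≤ (q : ℝ) * u + q * Λ + q * η - ((q : ℝ) * u - q * η) + 1 := h
      _ = q * (Λ + 2 * η) + 1 := by ring
      _ ≤ Q₂ * (Λ + 2 * η) + 1 := by gcongr
  have h1 : ((P.filter fun x : ℝ => ∃ q : ℕ, Q₁ ≤ q ∧ q < Q₂ ∧ ∃ a : ℤ, |x - a / q| ≤ η).card : ℝ) ≤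
      ∑ q ∈ Finset.Ico Q₁ Q₂, ∑ a ∈ A q, ((C q a).card : ℝ) := by
    have h0 := Finset.card_le_card hcover
    have h2 : (((Finset.Ico Q₁ Q₂).biUnion fun q => (A q).biUnion fun a => C q a).card : ℝ) ≤
        ∑ q ∈ Finset.Ico Q₁ Q₂, (((A q).biUnion fun a => C q a).card : ℝ) := by
      exact_mod_cast Finset.card_biUnion_le
    have h3 : ∀ q, (((A q).biUnion fun a => C q a).card : ℝ) ≤ ∑ a ∈ A q, ((C q a).card : ℝ) := by
      intro q; exact_mod_cast Finset.card_biUnion_le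
    calc ((P.filter fun x : ℝ => ∃ q : ℕ, Q₁ ≤ q ∧ q < Q₂ ∧ ∃ a : ℤ, |x - a / q| ≤ η).card : ℝ)
        ≤ (((Finset.Ico Q₁ Q₂).biUnion fun q => (A q).biUnion fun a => C q a).card : ℝ) := by
          exact_mod_cast h0
      _ ≤ _ := h2
      _ ≤ _ := Finset.sum_le_sum fun q _ => h3 q
  have h2 : ∀ q ∈ Finset.Ico Q₁ Q₂, ∑ a ∈ A q, ((C q a).card : ℝ) ≤
      (Q₂ * (Λ + 2 * η) + 1) * (2 * η / δ + 1) := by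
    intro q hq
    rw [Finset.mem_Ico] at hq
    have hq0 : 0 < q := hQ₁.trans_le hq.1
    calc ∑ a ∈ A q, ((C q a).card : ℝ) ≤ ∑ _a ∈ A q, (2 * η / δ + 1) :=
          Finset.sum_le_sum fun a _ => hCcard q hq0 a
      _ = ((A q).card : ℝ) * (2 * η / δ + 1) := by rw [Finset.sum_const, nsmul_eq_mul]
      _ ≤ (Q₂ * (Λ + 2 * η) + 1) * (2 * η / δ + 1) := by
          gcongr; exact hAcard q hq.1 hq.2
  calc ((P.filter fun x : ℝ => ∃ q : ℕ, Q₁ ≤ q ∧ q < Q₂ ∧ ∃ a : ℤ, |x - a / q| ≤ η).card : ℝ)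
      ≤ ∑ q ∈ Finset.Ico Q₁ Q₂, ∑ a ∈ A q, ((C q a).card : ℝ) := h1
    _ ≤ ∑ _q ∈ Finset.Ico Q₁ Q₂, (Q₂ * (Λ + 2 * η) + 1) * (2 * η / δ + 1) := Finset.sum_le_sum h2
    _ = ((Q₂ : ℝ) - Q₁) * (Q₂ * (Λ + 2 * η) + 1) * (2 * η / δ + 1) := by
        rw [Finset.sum_const, nsmul_eq_mul, Nat.card_Ico, Nat.cast_sub hQ]; ring

end Literature.NumberTheory.DiophantineApproximation
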